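import Summits.MatrixMultiplication.MatrixMultiplication.Theorems.OutsiderSandwichPackingProfile
import Summits.MatrixMultiplication.MatrixMultiplication.Theorems.OutsiderSandwichPackingProfileLaser

/-!
# OutsiderSandwich — the route's `Assembly` item, proved by name
(decomp-mm lens 4 «minimal-counterexample / extremal reduction», gen 37; kernel K37-2)

The route's assembly item `Assembly` (stmt-MatrixMultiplication-27898, rank 1, open since birth) is
`CwTwoMMPerfect → LaserMergeOptimal → ω(ℂ) = 2` — TOP and BOTTOM of the outsider sandwich give the
summit.  Both halves of the implication are tree theorems since gen 9 (the packing profile):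
TOP ⟹ LNT (`perfectBeyondLaser_of_cwTwoMMPerfect`: a single perfect product `⟨m,m,m⟩ ≤ cw₂^{⊠N}`,
`m² ≥ 3^{(1-ε)N}`, beats the laser merge bound with margin `γ = 1/12`) and LNT ∧ BOTTOM ⟹ `ω = 2`
(`summit_of_perfectBeyondLaser`: a packing beyond the laser merge exponent contradicts
`LaserMergeOptimal` unless `ω = 2`).  This file composes them and closes the item BY NAME; no new
mathematics.
-/

set_option linter.dupNamespace false

namespace Summit.MatrixMultiplication.MatrixMultiplication.Theorems.OutsiderSandwichAssembly

open Summit.MatrixMultiplication.MatrixMultiplication.Theses.OutsiderSandwich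
  (CwTwoMMPerfect LaserMergeOptimal PerfectBeyondLaser Assembly)

/-- **Item `Assembly` of route OutsiderSandwich (stmt-MatrixMultiplication-27898), proved by name**:
TOP ∧ BOTTOM ⟹ `ω(ℂ) = 2`. [this route, g9 kernels composed] -/
theorem assembly_holds : Assembly := fun h₁ h₂ =>
  OutsiderSandwichPackingProfile.summit_of_perfectBeyondLaser
    (OutsiderSandwichPackingProfileLaser.perfectBeyondLaser_of_cwTwoMMPerfect h₁) h₂

end Summit.MatrixMultiplication.MatrixMultiplication.Theorems.OutsiderSandwichAssembly
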